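import Summits.AnomalousDissipation.AnomalousDissipation.Theorems.TwoAndHalfDTwohalfdNegCertificate
import Summits.AnomalousDissipation.AnomalousDissipation.Theorems.TwoAndHalfDTwohalfdNegCondensateAveragedIdentity
import Summits.AnomalousDissipation.AnomalousDissipation.Theorems.TwoAndHalfDTwohalfdNegCondensateMeanToolkit
import Summits.AnomalousDissipation.AnomalousDissipation.Theorems.TwoAndHalfDTwohalfdNegCondensatePowerFromDissipation
import Summits.AnomalousDissipation.AnomalousDissipation.Theorems.TwoAndHalfDTwohalfdNegCondensateCesaroField
import Summits.AnomalousDissipation.AnomalousDissipation.Theorems.TwoAndHalfDTwohalfdNegCondensateFluctuationMeans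
import Literature.Analysis.FluidPDE.SourcedScalarBudget
import Literature.Analysis.FluidPDE.LerayHopfUniformEnergyMomentum
import Literature.Analysis.FluidPDE.LongTimeAverageSubadditive

/-!
# Condensate theorem for the crux `TwoAndHalfD.TwohalfdNeg` (stmt-AnomalousDissipation-0211), layer 1:
# the approximate steady transport solution carried by one level of an anomalous family

Line `log-kantorovich-enstrophy-transfer`, lead c6.  The CONDENSATE THEOREM (layer 2, file
`TwoAndHalfDTwohalfdNegCondensate`): a planar Leray–Hopf family that condenses in `limsup`-mean `L²` onto a
smooth steady divergence-free field `V` carries every steadily sourced bounded-variance weak scalar with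
vanishing `limsup`-mean dissipation.  This file is layer 1: from ONE level of a putative anomalous family
(`limsup`-mean dissipation `> 3ε`, `limsup`-mean variance `< E_θ`, `limsup`-mean fluctuation energy
`⟨‖v − V‖²⟩ < δ`, tolerance `η ≥ ν`, `η² ≥ δ`) it produces the normalised weighted Cesàro mean
`Θ = (2/T²)∫₀ᵀ(T − τ)θ(τ)dτ` at a good time `T`, in `L²` with `∫Θ² ≤ 2E_θ`, power `∫Θh ≥ ε`, solving the
steady transport equation `div(ΘV) = h` up to `η (C_φ + C_∇φ + C_Δφ)(E_θ + 2)` against every smooth test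
`φ` (`exists_approxSolution`).  Ingredients: the registered stubs A (`stub_condensateAveragedIdentity`), B
(`stub_condensateMeanToolkit`), C (`stub_condensatePowerFromDissipation`), D (`stub_condensateCesaroField`),
E (`stub_condensateFluctuationMeans`), the honesty of the running means (`Torus.isBoundedUnder_timeMean_scalarL2Sq`,
`Torus.IsGlobalLerayHopf.isBoundedUnder_timeMean_energy`) to choose the good time (`exists_good_time`), and real
arithmetic (`approx_bound_algebra`).  Closes with the registered tools stub `stub_condensateSelection`.
Supports stmt-AnomalousDissipation-0211.
-/

namespace Summit.AnomalousDissipation.AnomalousDissipation.Theorems.TwohalfdNeg.Condensate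

open MeasureTheory Filter Topology Set
open scoped ENNReal NNReal InnerProductSpace
open Literature.Analysis.FunctionSpaces Literature.Analysis.FluidPDE

set_option linter.dupNamespace false
/-! ## Layer 1: one level of the family -/

section Level

variable {κ : ℝ} {g : UnitAddTorus (Fin 2) → EuclideanSpace ℝ (Fin 2)}
  {v₀ : UnitAddTorus (Fin 2) → EuclideanSpace ℝ (Fin 2)}
  {v : ℝ → UnitAddTorus (Fin 2) → EuclideanSpace ℝ (Fin 2)}
  {V : UnitAddTorus (Fin 2) → EuclideanSpace ℝ (Fin 2)}
  {h θ₀ : UnitAddTorus (Fin 2) → ℝ} {θ : ℝ → UnitAddTorus (Fin 2) → ℝ}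

/-- Interval integrability on `[0, T]` of `t ↦ ∫ θ(t) c` for a continuous steady `c`, for a global weak
sourced scalar. [folklore] -/
theorem intervalIntegrable_integral_mul (hθ : Torus.IsWeakScalarTransportForced κ v (fun _ => h) θ₀ θ)
    {c : UnitAddTorus (Fin 2) → ℝ} (hc : Continuous c) {T : ℝ} (hT : 0 < T) :
    IntervalIntegrable (fun t => ∫ x, θ t x * c x) volume 0 T := by
  rw [intervalIntegrable_iff_integrableOn_Ioc_of_le hT.le, integrableOn_Ioc_iff_integrableOn_Ioo]
  exact ((hθ T hT).integrable_mul_continuous hc).integral_prod_left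

/-- Interval integrability on `[0, T]` of the variance `t ↦ ‖θ(t)‖²`. [folklore] -/
theorem intervalIntegrable_scalarL2Sq (hθ : Torus.IsWeakScalarTransportForced κ v (fun _ => h) θ₀ θ)
    {T : ℝ} (hT : 0 < T) :
    IntervalIntegrable (fun t => Torus.scalarL2Sq (θ t)) volume 0 T := by
  rw [intervalIntegrable_iff_integrableOn_Ioc_of_le hT.le]
  exact (Torus.integrableOn_scalarL2Sq hθ hT).1

/-- `∫₀ᵀ F = T · timeMean F T` for `T > 0`. [folklore] -/
theorem intervalIntegral_eq_mul_timeMean (F : ℝ → ℝ) {T : ℝ} (hT : 0 < T) :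
    ∫ t in (0 : ℝ)..T, F t = T * timeMean F T := by
  unfold timeMean
  rw [← mul_assoc, mul_inv_cancel₀ hT.ne', one_mul]

/-- `|∫ θ₀ φ| ≤ C_φ (1 + ∫ θ₀²)/2` for `θ₀ ∈ L²` and `|φ| ≤ C_φ`. [folklore] -/
theorem abs_integral_datum_mul_le (hθ₀ : MemLp θ₀ 2 volume) {φ : UnitAddTorus (Fin 2) → ℝ}
    {Cφ : ℝ} (hφb : ∀ x, |φ x| ≤ Cφ) :
    |∫ x, θ₀ x * φ x| ≤ Cφ * (1 + ∫ x, θ₀ x ^ 2) / 2 := by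
  have hCφ0 : 0 ≤ Cφ := (abs_nonneg _).trans (hφb 0)
  have hi : Integrable (fun x => Cφ * (1 + θ₀ x ^ 2) / 2) volume :=
    ((integrable_const (1 : ℝ)).add hθ₀.integrable_sq).const_mul Cφ |>.div_const 2
  have hle : ∀ x, ‖θ₀ x * φ x‖ ≤ Cφ * (1 + θ₀ x ^ 2) / 2 := fun x => by
    rw [Real.norm_eq_abs, abs_mul]
    have h1 : |θ₀ x| * |φ x| ≤ |θ₀ x| * Cφ := mul_le_mul_of_nonneg_left (hφb x) (abs_nonneg _)
    have h2 : |θ₀ x| ≤ (1 + θ₀ x ^ 2) / 2 := by nlinarith [sq_nonneg (|θ₀ x| - 1), sq_abs (θ₀ x)]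
    nlinarith
  calc |∫ x, θ₀ x * φ x| = ‖∫ x, θ₀ x * φ x‖ := (Real.norm_eq_abs _).symm
    _ ≤ ∫ x, Cφ * (1 + θ₀ x ^ 2) / 2 := norm_integral_le_of_norm_le hi (Eventually.of_forall hle)
    _ = Cφ * (1 + ∫ x, θ₀ x ^ 2) / 2 := by
        rw [integral_div, integral_const_mul, integral_add (integrable_const _) hθ₀.integrable_sq]
        simp

/-- **A good averaging time exists.** If the `limsup`-mean dissipation exceeds `3ε`, the `limsup`-mean
variance is `< E_θ` and the `limsup`-mean fluctuation energy around `V` is `< δ`, then (all three running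
means being honest: eventually bounded) there is an arbitrarily large `s` with running mean dissipation
`> 3ε` on `[0, s]`, running mean variance `< E_θ` and running mean fluctuation `< δ` on `[0, 2s]`. [folklore] -/
theorem exists_good_time (hκ : 0 < κ) (hgs : Torus.IsSmooth g) (hgz : Torus.HasZeroMean g)
    (hLH : Torus.IsGlobalLerayHopf κ (fun _ => g) v₀ v) (hV : Continuous V)
    (hhs : Torus.IsSmooth h) (hhz : Torus.HasZeroMean h) (hθ₀ : MemLp θ₀ 2 volume)
    (hθ : Torus.IsWeakScalarTransportForced κ v (fun _ => h) θ₀ θ) {ε Eθ δ L : ℝ}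
    (hD : 3 * ε < longTimeAvgSup (fun t => κ * (Torus.eScalarGradNormSq (θ t)).toReal))
    (hS : longTimeAvgSup (fun t => Torus.scalarL2Sq (θ t)) < Eθ)
    (hW : longTimeAvgSup (fun t => ∫ x, ‖v t x - V x‖ ^ 2) < δ) :
    ∃ s : ℝ, L ≤ s ∧ 3 * ε < timeMean (fun t => κ * (Torus.eScalarGradNormSq (θ t)).toReal) s ∧
      timeMean (fun t => Torus.scalarL2Sq (θ t)) (2 * s) < Eθ ∧
      timeMean (fun t => ∫ x, ‖v t x - V x‖ ^ 2) (2 * s) < δ := by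
  have hG : ∀ T, 0 < T → ∫⁻ t in Set.Ioo 0 T, Torus.eGradNormSq (v t) ^ (1 / 2 : ℝ) < ⊤ := fun T hT =>
    QuietOfSubLog.lintegral_rpow_half_eGradNormSq_lt_top hLH hT
  -- honesty of the three running means
  have hSb : IsBoundedUnder (· ≤ ·) atTop (timeMean fun t => Torus.scalarL2Sq (θ t)) :=
    Torus.isBoundedUnder_timeMean_scalarL2Sq hκ hθ hθ₀ hhs hhz hG
  have hKb : IsBoundedUnder (· ≤ ·) atTop (timeMean fun t => ∫ x, ‖v t x‖ ^ 2) :=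
    Torus.IsGlobalLerayHopf.isBoundedUnder_timeMean_energy hκ (hgs.memLp 2) hgz hLH
  obtain ⟨hWi, hWle⟩ := stub_condensateFluctuationMeans κ g v₀ v V hκ (hgs.memLp 2) hLH hV
  have hWb : IsBoundedUnder (· ≤ ·) atTop (timeMean fun t => ∫ x, ‖v t x - V x‖ ^ 2) := by
    obtain ⟨M, hM⟩ := hKb
    rw [Filter.eventually_map] at hM
    refine ⟨2 * M + 2 * ∫ x, ‖V x‖ ^ 2, ?_⟩
    rw [Filter.eventually_map]
    filter_upwards [hM, eventually_gt_atTop (0 : ℝ)] with T hT hT0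
    exact (hWle T hT0).trans (by linarith)
  have hD0 : ∀ t, 0 ≤ κ * (Torus.eScalarGradNormSq (θ t)).toReal := fun t =>
    mul_nonneg hκ.le ENNReal.toReal_nonneg
  -- the eventual / frequent sets
  have e1 : ∀ᶠ T in atTop, timeMean (fun t => Torus.scalarL2Sq (θ t)) T < Eθ :=
    eventually_lt_of_limsup_lt hS hSb
  have e2 : ∀ᶠ T in atTop, timeMean (fun t => ∫ x, ‖v t x - V x‖ ^ 2) T < δ :=
    eventually_lt_of_limsup_lt hW hWb
  have f1 : ∃ᶠ s in atTop, 3 * ε < timeMean (fun t => κ * (Torus.eScalarGradNormSq (θ t)).toReal) s :=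
    frequently_lt_of_lt_limsup (isCoboundedUnder_le_timeMean_of_nonneg hD0) hD
  have h2 : Tendsto (fun s : ℝ => 2 * s) atTop atTop := tendsto_id.const_mul_atTop two_pos
  obtain ⟨s, hs1, hs2, hs3, hs4⟩ :=
    (f1.and_eventually ((h2.eventually e1).and ((h2.eventually e2).and (eventually_ge_atTop L)))).exists
  exact ⟨s, hs4, hs1, hs2, hs3⟩

/-- **The real arithmetic of layer 1.** With `N = 2/(2s)²`, the averaged identity (`hA`), the flux split
(`hR`), the boundary, Laplacian and datum bounds (`hb₁`, `hb₃`, `hc`), the running-mean bounds and the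
thresholds `1 + E_θ ≤ sη`, `1 + ∫θ₀² ≤ sη`, `κ ≤ η`, `δ ≤ η²` combine to
`|N I₂ + P| ≤ η (C_φ + C_g + C_l)(E_θ + 2)`. [folklore] -/
theorem approx_bound_algebra {s η κ δ Eθ Cφ Cg Cl C₀ I₁ I₂ I₃ B c P S SS WW : ℝ}
    (hs : 0 < s) (hη : 0 < η) (hκ : 0 < κ) (hκη : κ ≤ η) (hδη : δ ≤ η ^ 2) (hEθ : 0 ≤ Eθ)
    (hCφ : 0 ≤ Cφ) (hCg : 0 ≤ Cg) (hCl : 0 ≤ Cl) (hC₀ : 0 ≤ C₀)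
    (hsE : 1 + Eθ ≤ s * η) (hsD : 1 + C₀ ≤ s * η)
    (hA : I₁ + (2 * s) ^ 2 / 2 * P = B - 2 * s * c)
    (hR : |I₁ - I₂ - κ * I₃| ≤ Cg / 2 * (η * SS + η⁻¹ * WW))
    (hb₁ : |B| ≤ Cφ * (2 * s + S) / 2) (hb₃ : |I₃| ≤ 2 * s * (Cl * (2 * s + S) / 2))
    (hc : |c| ≤ Cφ * (1 + C₀) / 2) (hS : S ≤ 2 * s * Eθ)
    (hSS : SS ≤ 2 * s * (2 * s * Eθ)) (hWW : WW ≤ 2 * s * (2 * s * δ)) :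
    |2 / (2 * s) ^ 2 * I₂ + P| ≤ η * ((Cφ + Cg + Cl) * (Eθ + 2)) := by
  have hT0 : 0 < 2 * s := by positivity
  set N : ℝ := 2 / (2 * s) ^ 2 with hN
  clear_value N
  have hN0 : 0 < N := by rw [hN]; positivity
  have hNT : N * ((2 * s) ^ 2 / 2) = 1 := by rw [hN]; field_simp
  -- `N I₂ + P = N B - N (2s) c - κ N I₃ - N R`
  have key : N * I₂ + P = N * B - N * (2 * s * c) - κ * (N * I₃) - N * (I₁ - I₂ - κ * I₃) := by
    have hA' : I₁ = B - 2 * s * c - (2 * s) ^ 2 / 2 * P := by linarith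
    rw [hA']
    have : N * ((2 * s) ^ 2 / 2 * P) = P := by rw [← mul_assoc, hNT, one_mul]
    linear_combination (-1 : ℝ) * this
  rw [key]
  have bB : |N * B| ≤ η / 2 * Cφ := by
    rw [abs_mul, abs_of_pos hN0]
    calc N * |B| ≤ N * (Cφ * (2 * s + 2 * s * Eθ) / 2) := by
          refine mul_le_mul_of_nonneg_left (hb₁.trans ?_) hN0.le
          gcongr
      _ = Cφ * ((1 + Eθ) / (2 * s)) := by rw [hN]; field_simp
      _ ≤ Cφ * (η / 2) := by
          refine mul_le_mul_of_nonneg_left ?_ hCφ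
          rw [div_le_iff₀ hT0]; linarith
      _ = η / 2 * Cφ := by ring
  have bc : |N * (2 * s * c)| ≤ η / 2 * Cφ := by
    rw [abs_mul, abs_of_pos hN0, abs_mul, abs_of_pos hT0]
    calc N * (2 * s * |c|) ≤ N * (2 * s * (Cφ * (1 + C₀) / 2)) := by gcongr
      _ = Cφ * ((1 + C₀) / (2 * s)) := by rw [hN]; field_simp
      _ ≤ Cφ * (η / 2) := by
          refine mul_le_mul_of_nonneg_left ?_ hCφ
          rw [div_le_iff₀ hT0]; linarith
      _ = η / 2 * Cφ := by ring
  have bI₃ : |κ * (N * I₃)| ≤ η * (Cl * (1 + Eθ)) := by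
    rw [abs_mul, abs_of_pos hκ, abs_mul, abs_of_pos hN0]
    calc κ * (N * |I₃|) ≤ η * (N * (2 * s * (Cl * (2 * s + 2 * s * Eθ) / 2))) := by
          refine mul_le_mul hκη (mul_le_mul_of_nonneg_left (hb₃.trans ?_) hN0.le) (by positivity) hη.le
          gcongr
      _ = η * (Cl * (1 + Eθ)) := by rw [hN]; field_simp
  have hδ' : η⁻¹ * δ ≤ η := by
    rw [inv_mul_le_iff₀ hη, ← pow_two]
    exact hδη
  have bR : |N * (I₁ - I₂ - κ * I₃)| ≤ η * (Cg * (Eθ + 1)) := by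
    rw [abs_mul, abs_of_pos hN0]
    calc N * |I₁ - I₂ - κ * I₃| ≤ N * (Cg / 2 * (η * SS + η⁻¹ * WW)) :=
          mul_le_mul_of_nonneg_left hR hN0.le
      _ ≤ N * (Cg / 2 * (η * (2 * s * (2 * s * Eθ)) + η⁻¹ * (2 * s * (2 * s * δ)))) := by gcongr
      _ = Cg * (η * Eθ + η⁻¹ * δ) := by rw [hN]; field_simp
      _ ≤ Cg * (η * Eθ + η) := by gcongr
      _ = η * (Cg * (Eθ + 1)) := by ring
  calc |N * B - N * (2 * s * c) - κ * (N * I₃) - N * (I₁ - I₂ - κ * I₃)|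
      ≤ |N * B - N * (2 * s * c) - κ * (N * I₃)| + |N * (I₁ - I₂ - κ * I₃)| := abs_sub _ _
    _ ≤ |N * B - N * (2 * s * c)| + |κ * (N * I₃)| + |N * (I₁ - I₂ - κ * I₃)| := by
        gcongr; exact abs_sub _ _
    _ ≤ |N * B| + |N * (2 * s * c)| + |κ * (N * I₃)| + |N * (I₁ - I₂ - κ * I₃)| := by
        gcongr; exact abs_sub _ _
    _ ≤ η / 2 * Cφ + η / 2 * Cφ + η * (Cl * (1 + Eθ)) + η * (Cg * (Eθ + 1)) := by
        gcongr
    _ = η * (Cφ + (Cg + Cl) * (Eθ + 1)) := by ring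
    _ ≤ η * ((Cφ + Cg + Cl) * (Eθ + 2)) := by
        refine mul_le_mul_of_nonneg_left ?_ hη.le
        nlinarith [mul_nonneg hCφ hEθ]

/-- **Layer 1 — the approximate steady transport solution carried by one level.** For one planar
Leray–Hopf flow `v` (viscosity `κ`, steady smooth mean-zero force `g`), one continuous steady field `V`,
one global weak sourced scalar `θ` (smooth mean-zero source `h`, `L²` datum) with `limsup`-mean dissipation
`> 3ε`, `limsup`-mean variance `< E_θ` and `limsup`-mean fluctuation energy `⟨‖v − V‖²⟩ < δ`, and a
tolerance `η` with `κ ≤ η`, `δ ≤ η²`: the normalised weighted Cesàro mean `Θ = (2/T²)∫₀ᵀ(T − τ)θ(τ)dτ` at a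
good time `T` is in `L²` with `∫Θ² ≤ 2E_θ`, has power `∫Θh ≥ ε`, and solves `div(ΘV) = h` up to
`η (C_φ + C_∇φ + C_Δφ)(E_θ + 2)` against every smooth `φ`. Composition of stubs A–E. [folklore] -/
theorem exists_approxSolution (hκ : 0 < κ) (hgs : Torus.IsSmooth g) (hgz : Torus.HasZeroMean g)
    (hLH : Torus.IsGlobalLerayHopf κ (fun _ => g) v₀ v) (hV : Continuous V)
    (hhs : Torus.IsSmooth h) (hhz : Torus.HasZeroMean h) (hθ₀ : MemLp θ₀ 2 volume)
    (hθ : Torus.IsWeakScalarTransportForced κ v (fun _ => h) θ₀ θ) {ε Eθ δ η : ℝ} (hε : 0 < ε)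
    (hD : 3 * ε < longTimeAvgSup (fun t => κ * (Torus.eScalarGradNormSq (θ t)).toReal))
    (hS : longTimeAvgSup (fun t => Torus.scalarL2Sq (θ t)) < Eθ)
    (hW : longTimeAvgSup (fun t => ∫ x, ‖v t x - V x‖ ^ 2) < δ)
    (hη : 0 < η) (hκη : κ ≤ η) (hδη : δ ≤ η ^ 2) :
    ∃ Θ : UnitAddTorus (Fin 2) → ℝ, MemLp Θ 2 volume ∧ ∫ x, Θ x ^ 2 ≤ 2 * Eθ ∧
      ε ≤ ∫ x, Θ x * h x ∧
      ∀ (φ : UnitAddTorus (Fin 2) → ℝ) (Cφ Cg Cl : ℝ), Torus.IsSmooth φ → (∀ x, |φ x| ≤ Cφ) →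
        (∀ x, ‖Torus.gradient φ x‖ ≤ Cg) → (∀ x, |Torus.laplacian φ x| ≤ Cl) →
        |(∫ x, Θ x * ⟪V x, Torus.gradient φ x⟫_ℝ) + ∫ x, h x * φ x| ≤
          η * ((Cφ + Cg + Cl) * (Eθ + 2)) := by
  have hG : ∀ T, 0 < T → ∫⁻ t in Set.Ioo 0 T, Torus.eGradNormSq (v t) ^ (1 / 2 : ℝ) < ⊤ := fun T hT =>
    QuietOfSubLog.lintegral_rpow_half_eGradNormSq_lt_top hLH hT
  have hC₀0 : 0 ≤ ∫ x, θ₀ x ^ 2 := integral_nonneg fun _ => sq_nonneg _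
  have hS0 : ∀ t, 0 ≤ Torus.scalarL2Sq (θ t) := fun t => Torus.scalarL2Sq_nonneg _
  have hW0 : ∀ t, 0 ≤ ∫ x, ‖v t x - V x‖ ^ 2 := fun t => integral_nonneg fun _ => sq_nonneg _
  have hD0 : ∀ t, 0 ≤ κ * (Torus.eScalarGradNormSq (θ t)).toReal := fun t =>
    mul_nonneg hκ.le ENNReal.toReal_nonneg
  have hEθ0 : 0 < Eθ := (longTimeAvgSup_nonneg hS0).trans_lt hS
  have hδ0 : 0 < δ := (longTimeAvgSup_nonneg hW0).trans_lt hW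
  -- a good time beyond the thresholds
  obtain ⟨s, hLs, hDs, hSs, hWs⟩ := exists_good_time hκ hgs hgz hLH hV hhs hhz hθ₀ hθ hD hS hW
    (L := max 1 (max ((∫ x, θ₀ x ^ 2) / ε) (max ((1 + Eθ) / η) ((1 + ∫ x, θ₀ x ^ 2) / η))))
  have hs1 : 1 ≤ s := (le_max_left _ _).trans hLs
  have hs0 : 0 < s := one_pos.trans_le hs1
  have hsC : (∫ x, θ₀ x ^ 2) / ε ≤ s := ((le_max_left _ _).trans (le_max_right _ _)).trans hLs
  have hsE : (1 + Eθ) / η ≤ s :=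
    (((le_max_left _ _).trans (le_max_right _ _)).trans (le_max_right _ _)).trans hLs
  have hsD : (1 + ∫ x, θ₀ x ^ 2) / η ≤ s :=
    (((le_max_right _ _).trans (le_max_right _ _)).trans (le_max_right _ _)).trans hLs
  have hT0 : 0 < 2 * s := by positivity
  rw [div_le_iff₀ hε] at hsC
  rw [div_le_iff₀ hη] at hsE hsD
  -- the stubs at this level
  obtain ⟨hB1, hB2, hB3, hB4⟩ := stub_condensateMeanToolkit
  obtain ⟨hWi, -⟩ := stub_condensateFluctuationMeans κ g v₀ v V hκ (hgs.memLp 2) hLH hV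
  obtain ⟨hΘmem, hΘsq, hΘpair⟩ := stub_condensateCesaroField κ (2 * s) v h θ₀ θ hT0 hθ
  have hPow := stub_condensatePowerFromDissipation κ (2 * s) v h θ₀ θ hκ hT0 hθ hθ₀ hhs hG
  -- integrability on `[0, T]`
  have hSi : IntervalIntegrable (fun t => Torus.scalarL2Sq (θ t)) volume 0 (2 * s) :=
    intervalIntegrable_scalarL2Sq hθ hT0
  have hWi' : IntervalIntegrable (fun t => ∫ x, ‖v t x - V x‖ ^ 2) volume 0 (2 * s) := by
    rw [intervalIntegrable_iff_integrableOn_Ioc_of_le hT0.le]; exact hWi _ hT0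
  have hpi : IntervalIntegrable (fun t => ∫ x, θ t x * h x) volume 0 (2 * s) :=
    intervalIntegrable_integral_mul hθ hhs.continuous hT0
  -- running means at `T = 2s`
  have hSmean : ∫ t in (0 : ℝ)..(2 * s), Torus.scalarL2Sq (θ t) ≤ 2 * s * Eθ := by
    rw [intervalIntegral_eq_mul_timeMean _ hT0]
    exact mul_le_mul_of_nonneg_left hSs.le hT0.le
  have hWmean : ∫ t in (0 : ℝ)..(2 * s), ∫ x, ‖v t x - V x‖ ^ 2 ≤ 2 * s * δ := by
    rw [intervalIntegral_eq_mul_timeMean _ hT0]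
    exact mul_le_mul_of_nonneg_left hWs.le hT0.le
  have hDmean : s * (3 * ε) ≤ ∫ t in (0 : ℝ)..s, κ * (Torus.eScalarGradNormSq (θ t)).toReal := by
    rw [intervalIntegral_eq_mul_timeMean _ hs0]
    exact mul_le_mul_of_nonneg_left hDs.le hs0.le
  -- double Cesàro integrals of `S` and `W`
  have hSS : ∫ t in (0 : ℝ)..(2 * s), ∫ τ in (0 : ℝ)..t, Torus.scalarL2Sq (θ τ) ≤ 2 * s * (2 * s * Eθ) :=
    (hB4 _ _ hT0.le hSi hS0).trans (mul_le_mul_of_nonneg_left hSmean hT0.le)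
  have hWW : ∫ t in (0 : ℝ)..(2 * s), ∫ τ in (0 : ℝ)..t, ∫ x, ‖v τ x - V x‖ ^ 2 ≤ 2 * s * (2 * s * δ) :=
    (hB4 _ _ hT0.le hWi' hW0).trans (mul_le_mul_of_nonneg_left hWmean hT0.le)
  set N : ℝ := 2 / (2 * s) ^ 2 with hN
  have hN0 : 0 < N := by positivity
  have hNT : N * ((2 * s) ^ 2 / 2) = 1 := by rw [hN]; field_simp
  refine ⟨fun x => N * ∫ τ in (0 : ℝ)..(2 * s), (2 * s - τ) * θ τ x, hΘmem.const_mul N, ?_, ?_, ?_⟩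
  · -- `∫ Θ² ≤ 2 E_θ`
    have e1 : ∫ x, (N * ∫ τ in (0 : ℝ)..(2 * s), (2 * s - τ) * θ τ x) ^ 2 =
        N ^ 2 * ∫ x, (∫ τ in (0 : ℝ)..(2 * s), (2 * s - τ) * θ τ x) ^ 2 := by
      rw [← integral_const_mul]
      refine integral_congr_ae (Eventually.of_forall fun x => ?_)
      simp only [mul_pow]
    rw [e1]
    have e2 : ∫ τ in (0 : ℝ)..(2 * s), (2 * s - τ) * Torus.scalarL2Sq (θ τ) =
        ∫ t in (0 : ℝ)..(2 * s), ∫ τ in (0 : ℝ)..t, Torus.scalarL2Sq (θ τ) := (hB3 _ _ hT0.le hSi).symm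
    calc N ^ 2 * ∫ x, (∫ τ in (0 : ℝ)..(2 * s), (2 * s - τ) * θ τ x) ^ 2
        ≤ N ^ 2 * ((2 * s) ^ 2 / 2 * (2 * s * (2 * s * Eθ))) := by
          refine mul_le_mul_of_nonneg_left (hΘsq.trans ?_) (sq_nonneg _)
          rw [e2]
          exact mul_le_mul_of_nonneg_left hSS (by positivity)
      _ = 2 * Eθ := by rw [hN]; field_simp
  · -- the power `∫ Θ h ≥ ε`
    have e1 : ∫ x, (N * ∫ τ in (0 : ℝ)..(2 * s), (2 * s - τ) * θ τ x) * h x =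
        N * ∫ t in (0 : ℝ)..(2 * s), ∫ τ in (0 : ℝ)..t, ∫ x, θ τ x * h x := by
      rw [hB3 _ _ hT0.le hpi, ← hΘpair h hhs.continuous, ← integral_const_mul]
      refine integral_congr_ae (Eventually.of_forall fun x => ?_)
      simp only [mul_assoc]
    rw [e1]
    -- `∫₀ˢ D ≤ ∫₀^{T/2} D` is an equality of endpoints
    have e2 : (2 * s) / 2 = s := by ring
    rw [e2] at hPow
    have h1 : 2 * s / 2 * (s * (3 * ε)) - 2 * s * (1 / 2 * ∫ x, θ₀ x ^ 2) ≤
        ∫ t in (0 : ℝ)..(2 * s), ∫ τ in (0 : ℝ)..t, ∫ x, θ τ x * h x := by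
      have := mul_le_mul_of_nonneg_left hDmean (by positivity : (0 : ℝ) ≤ 2 * s / 2)
      linarith
    have h2 : ε ≤ N * (2 * s / 2 * (s * (3 * ε)) - 2 * s * (1 / 2 * ∫ x, θ₀ x ^ 2)) := by
      rw [hN]
      have h3 : 2 / (2 * s) ^ 2 * (2 * s / 2 * (s * (3 * ε)) - 2 * s * (1 / 2 * ∫ x, θ₀ x ^ 2)) =
          3 / 2 * ε - (∫ x, θ₀ x ^ 2) / (2 * s) := by field_simp
      rw [h3]
      have h4 : (∫ x, θ₀ x ^ 2) / (2 * s) ≤ ε / 2 := by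
        rw [div_le_iff₀ hT0]; linarith
      linarith
    exact h2.trans (mul_le_mul_of_nonneg_left h1 hN0.le)
  · -- the approximate equation
    intro φ Cφ Cg Cl hφ hφb hgb hlb
    have hCφ0 : 0 ≤ Cφ := (abs_nonneg _).trans (hφb 0)
    have hCg0 : 0 ≤ Cg := (norm_nonneg _).trans (hgb 0)
    have hCl0 : 0 ≤ Cl := (abs_nonneg _).trans (hlb 0)
    have hψc : Continuous fun x => ⟪V x, Torus.gradient φ x⟫_ℝ := hV.inner hφ.gradient.continuous
    have hψi : IntervalIntegrable (fun t => ∫ x, θ t x * ⟪V x, Torus.gradient φ x⟫_ℝ) volume 0 (2 * s) :=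
      intervalIntegrable_integral_mul hθ hψc hT0
    have hφi : IntervalIntegrable (fun t => ∫ x, θ t x * φ x) volume 0 (2 * s) :=
      intervalIntegrable_integral_mul hθ hφ.continuous hT0
    -- the five pieces
    have hA := stub_condensateAveragedIdentity κ (2 * s) v h θ₀ θ φ hT0 hθ hφ
    have hR := hB2 κ (2 * s) Cg η v V h θ₀ θ φ hT0 hη hθ hV hφ hgb (hWi _ hT0)
    have hb₁ := (hB1 κ (2 * s) Cφ v h θ₀ θ φ hT0 hθ hφ.continuous hφb).1
    have hb₃ := (hB1 κ (2 * s) Cl v h θ₀ θ (Torus.laplacian φ) hT0 hθ hφ.laplacian.continuous hlb).2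
    have hdat := abs_integral_datum_mul_le hθ₀ hφb
    -- rewrite the pairing through the double Cesàro integral
    have e1 : ∫ x, (N * ∫ τ in (0 : ℝ)..(2 * s), (2 * s - τ) * θ τ x) * ⟪V x, Torus.gradient φ x⟫_ℝ =
        N * ∫ t in (0 : ℝ)..(2 * s), ∫ τ in (0 : ℝ)..t, ∫ x, θ τ x * ⟪V x, Torus.gradient φ x⟫_ℝ := by
      rw [hB3 _ _ hT0.le hψi, ← hΘpair _ hψc, ← integral_const_mul]
      refine integral_congr_ae (Eventually.of_forall fun x => ?_)
      simp only [mul_assoc]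
    rw [e1, hN]
    -- the boundary average
    have e2 : ∫ t in (0 : ℝ)..(2 * s), ((∫ x, θ t x * φ x) - ∫ x, θ₀ x * φ x) =
        (∫ t in (0 : ℝ)..(2 * s), ∫ x, θ t x * φ x) - 2 * s * ∫ x, θ₀ x * φ x := by
      rw [intervalIntegral.integral_sub hφi intervalIntegrable_const, intervalIntegral.integral_const,
        sub_zero, smul_eq_mul]
    rw [e2] at hA
    exact approx_bound_algebra hs0 hη hκ hκη hδη hEθ0.le hCφ0 hCg0 hCl0 hC₀0 hsE hsD hA hR hb₁ hb₃ hdat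
      hSmean hSS hWW

/-- **Registered tools stub `stub_condensateSelection`** (layer 1 of the condensate theorem, registered on
stmt-AnomalousDissipation-0211 with `ledger workitem stub-add`): the explicit form of `exists_approxSolution`.
[folklore] -/
theorem stub_condensateSelection :
    ∀ (κ : ℝ) (g : UnitAddTorus (Fin 2) → EuclideanSpace ℝ (Fin 2))
      (v₀ : UnitAddTorus (Fin 2) → EuclideanSpace ℝ (Fin 2))
      (v : ℝ → UnitAddTorus (Fin 2) → EuclideanSpace ℝ (Fin 2))
      (V : UnitAddTorus (Fin 2) → EuclideanSpace ℝ (Fin 2))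
      (h θ₀ : UnitAddTorus (Fin 2) → ℝ) (θ : ℝ → UnitAddTorus (Fin 2) → ℝ) (ε Eθ δ η : ℝ),
      0 < κ → Torus.IsSmooth g → Torus.HasZeroMean g → Torus.IsGlobalLerayHopf κ (fun _ => g) v₀ v →
      Continuous V → Torus.IsSmooth h → Torus.HasZeroMean h → MemLp θ₀ 2 volume →
      Torus.IsWeakScalarTransportForced κ v (fun _ => h) θ₀ θ → 0 < ε →
      3 * ε < longTimeAvgSup (fun t => κ * (Torus.eScalarGradNormSq (θ t)).toReal) →
      longTimeAvgSup (fun t => Torus.scalarL2Sq (θ t)) < Eθ →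
      longTimeAvgSup (fun t => ∫ x, ‖v t x - V x‖ ^ 2) < δ →
      0 < η → κ ≤ η → δ ≤ η ^ 2 →
      ∃ Θ : UnitAddTorus (Fin 2) → ℝ, MemLp Θ 2 volume ∧ ∫ x, Θ x ^ 2 ≤ 2 * Eθ ∧
        ε ≤ ∫ x, Θ x * h x ∧
        ∀ (φ : UnitAddTorus (Fin 2) → ℝ) (Cφ Cg Cl : ℝ), Torus.IsSmooth φ → (∀ x, |φ x| ≤ Cφ) →
          (∀ x, ‖Torus.gradient φ x‖ ≤ Cg) → (∀ x, |Torus.laplacian φ x| ≤ Cl) →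
          |(∫ x, Θ x * inner ℝ (V x) (Torus.gradient φ x)) + ∫ x, h x * φ x| ≤
            η * ((Cφ + Cg + Cl) * (Eθ + 2)) :=
  fun _κ _g _v₀ _v _V _h _θ₀ _θ _ε _Eθ _δ _η hκ hgs hgz hLH hV hhs hhz hθ₀ hθ hε hD hS hW hη hκη hδη =>
    exists_approxSolution hκ hgs hgz hLH hV hhs hhz hθ₀ hθ hε hD hS hW hη hκη hδη

end Level

end Summit.AnomalousDissipation.AnomalousDissipation.Theorems.TwohalfdNeg.Condensate
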